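import Literature.Probability.RandomPlanarGeometry.SAWQuantitativeHWRational
import Literature.Probability.RandomPlanarGeometry.HammersleyWelshExplicitZ2
import Literature.Probability.RandomPlanarGeometry.SAWTiltedFiniteMemory16T3x2
import Mathlib.Analysis.Real.Pi.Bounds
import HarnessLib

/-!
# Explicit Hammersley–Welsh on `ℤ²` at every certified speed: `B(v) = π(2v/3)^{1/2}`;
# the instance `v = 9/20`: `c_N ≤ e^{π√(3N/10) + 3π²/20 + 1} · μ^{N+1}` for every `N ≥ 5400`

Topic `Literature/Probability/RandomPlanarGeometry`, on top of `SAWQuantitativeHWRational.lean` (product-form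
Hutchcroft Theorem 1.4 under a RATIONAL window, `Zd.count_le_exp_sharp_of_windowQ`: exponent `π√(2pN/(3q))`
from `Zd.BridgeHeightDecayWindowQ d p q A c`, the prefactor `A` immaterial), `HammersleyWelshExplicitZ2.lean`
(the speed-`1/2` case: `Zd.count_le_exp_sharp_two`, constant `π(1/3)^{1/2}`, `N ≥ 791`) and the tree's tilted
memory-16 Pönitz–Tittmann certificates (`FiniteMemory.checkW_16_3_2`: tilt `3/2`, `λ̄ = 3.078458`;
`SAW.card_xEnd_ge_speed_le_exp`: tilt `11/9`, every speed `v > v₀ = 0.3828…`).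

Sources (printed anchors): J. M. Hammersley, D. J. A. Welsh (1962) / N. Madras, G. Slade (1993), Theorem 3.1.1:
"`c_N ≤ μ^{N+1} e^{BN^{1/2}}` for all `N ≥ N₀(B)`, any `B > π(2/3)^{1/2}`"; T. Hutchcroft (2018), Theorems 1.2
and 1.4 (ineffective `exp[o(n^{1/2})]` from sub-ballisticity; windowed hypothesis (1.1)); H. Duminil-Copin,
A. Hammond (2013), Theorem 1.1 (sub-ballisticity, inexplicit rate). What is new in THIS FILE (lane pcv-sawmu,
route R7 "X19♯"; not in print): on `ℤ²`, an endpoint bound at speed `v = p/q` with an explicit exponential rate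
gives the rational window at aspect ratio `q/p` with an EXPLICIT prefactor, hence the effective bound
`c_N ≤ exp(B(v)√N + B(v)²/2 + 1)·μ^{N+1}`, `B(v) = π(2v/3)^{1/2}`, for all `N` beyond two explicit side conditions;
and the DISCHARGED instance `v = 9/20` from the tilt-`3/2` certificate: `B(9/20) = π(3/10)^{1/2} ≈ 1.7207`
(`< π(1/3)^{1/2} ≈ 1.8138 < π(2/3)^{1/2} ≈ 2.5651`), threshold `N ≥ 5400`. The dictionary at other certified
speeds (informational; tilt `11/9`, rate `(v - v₀)·log(11/9)`): `v = 0.42 ↦ B = 1.6624`, `N₀ ≈ 2.4·10⁴`;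
`v = 0.40 ↦ 1.6223`, `N₀ ≈ 1.3·10⁵`; `v ↓ v₀ = 0.3828… ↦ B₀ = 1.5870` (the floor of this certificate method).
AXIOMS: the computational lineage of the certificates (`native_decide` in `SAWTiltedFiniteMemory16T3x2.lean`,
`SAWTiltedFiniteMemory16T11x9.lean`, `SAWLowerBound2604.lean`) — nothing else beyond the standard three.

## Contents (namespaces `Literature.Probability.RandomPlanarGeometry.SAW` / `….SAW.Zd`), all PROVED
* `Zd.bridgeHeightDecayWindowQ_two_of_endpointBound` — a relative endpoint bound at speed `p/q` with rate `ε`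
  (`W > 0`) gives `Zd.BridgeHeightDecayWindowQ 2 p q A c` for every `0 ≤ c < ε`, `A = 16 W e^{π²/(3(ε-c))}/(ε-c)`;
* `Zd.count_le_exp_sharp_two_of_endpointBoundQ` — hence `c_N ≤ exp(π√(2pN/(3q)) + π²p/(3q) + 1) μ^{N+1}` for every
  `0 < c < ε` and all `N` with `2π²p ≤ 3qN`, `π²p((q-p)/(pc)+1)² ≤ 6qN`;
* `Zd.count_le_exp_sharp_two_of_speed` — the same from the tree's tilt-`11/9` certificate, for every rational
  `p/q` and every `0 < c < (p/q - v₀)·log(11/9)`;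
* `card_xEnd_ge_nineTwentieths_le` / `card_xEnd_ge_nineTwentieths_le_exp` — speed `9/20` from the tilt-`3/2`
  certificate: `#{x(ω_n) ≥ 9n/20} ≤ 2⁴¹ · (73883/28800)ⁿ = 2⁴¹ · 2.56538…ⁿ` and `≤ 2⁴¹ e^{-n/68} c_n`;
* **`Zd.count_le_exp_nineTwentieths_two`** — `∀ N ≥ 5400, c_N ≤ e^{π√(3N/10) + 3π²/20 + 1} · μ^{N+1}` on `ℤ²`.
-/

noncomputable section

open Finset Literature.Probability.RandomPlanarGeometry.SAW

namespace Literature.Probability.RandomPlanarGeometry.SAW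

namespace Zd

/-- **Endpoint bound at speed `p/q` ⇒ Hutchcroft's window at aspect ratio `q/p`** (`1 ≤ p ≤ q`): if
`#{ω ∈ SAW_m(ℤ²) : ω_m(0) ≥ (p/q) m} ≤ W e^{-εm} c_m` for all `m ≥ 1` (`W > 0`), then for every `0 ≤ c < ε`,
`Zd.BridgeHeightDecayWindowQ 2 p q A c` holds with `A = 16 W e^{π²/(3(ε-c))}/(ε-c)`: a bridge of length `m` and
height `n` with `p m ≤ q n` is an `m`-step SAW with `ω_m(0) ≥ (p/q) m`; `c_m ≤ 4 c_{m-1} ≤ 4 m e^{π√(2m/3)} b_m`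
(`Zd.count_le_sharp_mul_bridgeCount`); the surplus `e^{-(ε-c)m}` absorbs `m e^{π√(2m/3)}`
(`Zd.mul_exp_sqrt_exp_neg_le`). The case `p = 1`, `q = 2` is `Zd.bridgeHeightDecayWindow_two_of_endpointBound`.
[cite: Hutchcroft2018HammersleyWelsh, eq. (1.1) and Lemma 2.4 (windowed reading); DuminilCopinHammond2013, Theorem 1.1] -/
theorem bridgeHeightDecayWindowQ_two_of_endpointBound {W ε : ℝ} {p q : ℕ} (hp : 1 ≤ p) (hpq : p ≤ q)
    (hW : 0 < W)
    (h : ∀ m : ℕ, 1 ≤ m → ((((saws 2 m).filter fun ω => ((p : ℝ) / q) * m ≤ ((ω m 0 : ℤ) : ℝ)).card : ℝ)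
      ≤ W * Real.exp (-(ε * m)) * (count 2 m : ℝ)))
    {c : ℝ} (hc0 : 0 ≤ c) (hcε : c < ε) :
    BridgeHeightDecayWindowQ 2 p q (4 * W * 2 * (2 / (ε - c) * Real.exp (Real.pi ^ 2 / (3 * (ε - c))))) c := by
  classical
  have hq0 : (0 : ℝ) < q := by exact_mod_cast (lt_of_lt_of_le hp hpq)
  set δ : ℝ := ε - c with hδ
  have hδ0 : 0 < δ := by rw [hδ]; linarith
  intro m n hn hnm hpm
  have hm1 : 1 ≤ m := le_trans hn hnm
  have hm0 : (0 : ℝ) ≤ (m : ℝ) := Nat.cast_nonneg m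
  -- (1) the class lies in the endpoint event at length `m`: `(p/q) m ≤ n ≤ ω_m(0)`
  have hsub : ((bridges 2 m).filter fun ω => (n : ℤ) ≤ ω m 0) ⊆
      (saws 2 m).filter fun ω => ((p : ℝ) / q) * m ≤ ((ω m 0 : ℤ) : ℝ) := by
    intro ω hω
    rw [Finset.mem_filter] at hω ⊢
    refine ⟨(mem_bridges.1 hω.1).1, ?_⟩
    have h1 : (p : ℝ) * m ≤ q * n := by exact_mod_cast hpm
    have h2 : ((n : ℤ) : ℝ) ≤ ((ω m 0 : ℤ) : ℝ) := by exact_mod_cast hω.2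
    push_cast at h2
    rw [div_mul_eq_mul_div, div_le_iff₀ hq0]
    nlinarith
  have hX : (((bridges 2 m).filter fun ω => (n : ℤ) ≤ ω m 0).card : ℝ) ≤
      W * Real.exp (-(ε * m)) * (count 2 m : ℝ) :=
    le_trans (by exact_mod_cast Finset.card_le_card hsub) (h m hm1)
  -- (2) `c_m ≤ 4 c_{m-1} ≤ 4 m e^{π√(2m/3)} b_m`
  obtain ⟨k, rfl⟩ : ∃ k, m = k + 1 := ⟨m - 1, by omega⟩
  have hc4 : (count 2 (k + 1) : ℝ) ≤ 4 * count 2 k := by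
    have h1 := count_add_le 2 k 1
    have h2 := count_one_le 2
    have : count 2 (k + 1) ≤ 4 * count 2 k :=
      h1.trans (by calc count 2 k * count 2 1 ≤ count 2 k * (2 * 2) := Nat.mul_le_mul_left _ h2
        _ = 4 * count 2 k := by ring)
    exact_mod_cast this
  have hsharp := count_le_sharp_mul_bridgeCount (d := 2) k
  have habs := mul_exp_sqrt_exp_neg_le hδ0 hm0
  have hcn : Real.exp (-(c * ((k + 1 : ℕ) : ℝ))) ≤ Real.exp (-(c * n)) := by
    rw [Real.exp_le_exp]
    have : (n : ℝ) ≤ ((k + 1 : ℕ) : ℝ) := by exact_mod_cast hnm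
    nlinarith
  have hsplit : Real.exp (-(ε * ((k + 1 : ℕ) : ℝ))) =
      Real.exp (-(δ * ((k + 1 : ℕ) : ℝ))) * Real.exp (-(c * ((k + 1 : ℕ) : ℝ))) := by
    rw [← Real.exp_add, hδ]; ring_nf
  calc (((bridges 2 (k + 1)).filter fun ω => (n : ℤ) ≤ ω (k + 1) 0).card : ℝ)
      ≤ W * Real.exp (-(ε * ((k + 1 : ℕ) : ℝ))) * (count 2 (k + 1) : ℝ) := hX
    _ ≤ W * Real.exp (-(ε * ((k + 1 : ℕ) : ℝ))) * (4 * (((k : ℕ) : ℝ) + 1) *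
          Real.exp (Real.pi * Real.sqrt (2 * ((k : ℝ) + 1) / 3)) * bridgeCount 2 (k + 1)) := by
        refine mul_le_mul_of_nonneg_left (hc4.trans ?_) (mul_nonneg hW.le (Real.exp_nonneg _))
        linarith [hsharp]
    _ = 4 * W * ((((k + 1 : ℕ) : ℝ)) * Real.exp (Real.pi * Real.sqrt (2 * ((k + 1 : ℕ) : ℝ) / 3)) *
          Real.exp (-(δ * ((k + 1 : ℕ) : ℝ)))) * Real.exp (-(c * ((k + 1 : ℕ) : ℝ))) *
          bridgeCount 2 (k + 1) := by
        rw [hsplit]; push_cast; ring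
    _ ≤ 4 * W * (2 / δ * Real.exp (Real.pi ^ 2 / (3 * δ))) * Real.exp (-(c * n)) *
          bridgeCount 2 (k + 1) := by
        gcongr
    _ ≤ 4 * W * 2 * (2 / δ * Real.exp (Real.pi ^ 2 / (3 * δ))) * (bridgeCount 2 (k + 1) : ℝ) *
          Real.exp (-(c * n)) := by
        have h0 : 0 ≤ 4 * W * (2 / δ * Real.exp (Real.pi ^ 2 / (3 * δ))) * Real.exp (-(c * n)) *
            bridgeCount 2 (k + 1) := by positivity
        nlinarith [h0]

/-- **Explicit Hammersley–Welsh on `ℤ²` from an endpoint bound at speed `v = p/q`** (`1 ≤ p ≤ q`, `W > 0`,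
rate `ε`): for every `0 < c < ε` and all `N` with `2π²p ≤ 3qN` and `π²p((q-p)/(pc)+1)² ≤ 6qN`,
`c_N ≤ exp(π√(2pN/(3q)) + π²p/(3q) + 1) · μ^{N+1}` — the `√N`-constant is `B(v) = π(2v/3)^{1/2}`
(`Zd.count_le_exp_sharp_of_windowQ` on the window of `Zd.bridgeHeightDecayWindowQ_two_of_endpointBound`; the
prefactor is immaterial). [cite: Hutchcroft2018HammersleyWelsh, Theorem 1.4; MadrasSlade1993, Theorem 3.1.1] -/
theorem count_le_exp_sharp_two_of_endpointBoundQ {W ε : ℝ} {p q : ℕ} (hp : 1 ≤ p) (hpq : p ≤ q)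
    (hW : 0 < W)
    (h : ∀ m : ℕ, 1 ≤ m → ((((saws 2 m).filter fun ω => ((p : ℝ) / q) * m ≤ ((ω m 0 : ℤ) : ℝ)).card : ℝ)
      ≤ W * Real.exp (-(ε * m)) * (count 2 m : ℝ)))
    {c : ℝ} (hc0 : 0 < c) (hcε : c < ε) (N : ℕ)
    (hN1 : 2 * Real.pi ^ 2 * p ≤ 3 * (q : ℝ) * N)
    (hN2 : Real.pi ^ 2 * p * ((((q : ℝ) - p) / (p * c)) + 1) ^ 2 ≤ 6 * (q : ℝ) * N) :
    (count 2 N : ℝ) ≤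
      Real.exp (Real.pi * Real.sqrt (2 * p * N / (3 * (q : ℝ))) + Real.pi ^ 2 * p / (3 * (q : ℝ)) + 1) *
        connectiveConstant 2 ^ (N + 1) :=
  count_le_exp_sharp_of_windowQ (bridgeHeightDecayWindowQ_two_of_endpointBound hp hpq hW h hc0.le hcε)
    hp hpq hc0 N hN1 hN2

/-- **Explicit Hammersley–Welsh on `ℤ²` at every certified rational speed** (tilt `11/9`): for `1 ≤ p ≤ q`,
every `0 < c < (p/q - v₀)·log(11/9)` (`v₀ = SAW.speedThreshold = 0.3828…`; such `c` exist iff `p/q > v₀`) and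
all `N` with `2π²p ≤ 3qN`, `π²p((q-p)/(pc)+1)² ≤ 6qN`: `c_N ≤ exp(π√(2pN/(3q)) + π²p/(3q) + 1) · μ^{N+1}`
(the endpoint bound is `SAW.card_xEnd_ge_speed_le_exp`, `W = 2⁴¹`).
[cite: Hutchcroft2018HammersleyWelsh, Theorems 1.2 and 1.4; DuminilCopinHammond2013, Theorem 1.1; MadrasSlade1993, Theorem 3.1.1] -/
theorem count_le_exp_sharp_two_of_speed {p q : ℕ} (hp : 1 ≤ p) (hpq : p ≤ q) {c : ℝ} (hc0 : 0 < c)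
    (hc : c < ((p : ℝ) / q - speedThreshold) * Real.log ((11 : ℝ) / 9)) (N : ℕ)
    (hN1 : 2 * Real.pi ^ 2 * p ≤ 3 * (q : ℝ) * N)
    (hN2 : Real.pi ^ 2 * p * ((((q : ℝ) - p) / (p * c)) + 1) ^ 2 ≤ 6 * (q : ℝ) * N) :
    (count 2 N : ℝ) ≤
      Real.exp (Real.pi * Real.sqrt (2 * p * N / (3 * (q : ℝ))) + Real.pi ^ 2 * p / (3 * (q : ℝ)) + 1) *
        connectiveConstant 2 ^ (N + 1) := by
  refine count_le_exp_sharp_two_of_endpointBoundQ (W := 2 ^ 41)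
    (ε := ((p : ℝ) / q - speedThreshold) * Real.log ((11 : ℝ) / 9)) hp hpq (by norm_num) ?_ hc0 hc N hN1 hN2
  intro m _
  have h := card_xEnd_ge_speed_le_exp ((p : ℝ) / q) m
  have e : -(((p : ℝ) / q - speedThreshold) * Real.log ((11 : ℝ) / 9) * m) =
      -((((p : ℝ) / q - speedThreshold) * Real.log ((11 : ℝ) / 9)) * m) := by ring
  rw [e] at h
  exact h

end Zd

/-! ## The certified speed `9/20` (tilt `3/2`, `λ̄ = 18470750/(10⁶·6) = 3.078458…`) -/

open FiniteMemory

/-- **Speed `9/20`, μ-free count form** (tilt `3/2`, `(2/3)^{9/20} ≤ 5/6` since `(2/3)⁹ ≤ (5/6)²⁰`):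
`#{ω ∈ SAW_n : x(ω_n) ≥ 9n/20} ≤ 2⁴¹ · (73883/28800)ⁿ = 2⁴¹ · 2.565382…ⁿ` for every `n` (compare
`c_n ≥ μⁿ ≥ 2.604ⁿ`). [cite: DuminilCopinHammond2013, Theorem 1.1; PonitzTittmann2000, §3] -/
theorem card_xEnd_ge_nineTwentieths_le (n : ℕ) :
    (((Zd.saws 2 n).filter fun ω => (9 / 20 : ℝ) * n ≤ ((ω n 0 : ℤ) : ℝ)).card : ℝ) ≤
      2 ^ 41 * (73883 / 28800 : ℝ) ^ n := by
  have ht : ((2 : ℕ) / (3 : ℕ) : ℝ) ^ (9 / 20 : ℝ) ≤ 5 / 6 := by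
    have h0 : (0 : ℝ) ≤ ((2 : ℕ) / (3 : ℕ) : ℝ) := by norm_num
    have h20 : (((2 : ℕ) / (3 : ℕ) : ℝ) ^ (9 / 20 : ℝ)) ^ (20 : ℕ) ≤ (5 / 6 : ℝ) ^ (20 : ℕ) := by
      rw [← Real.rpow_natCast, ← Real.rpow_mul h0]
      norm_num
    exact (pow_le_pow_iff_left₀ (Real.rpow_nonneg h0 _) (by norm_num) (by norm_num)).1 h20
  have h := card_speed_le_of_checkW checkW_16_3_2 (by norm_num) (by norm_num) (by norm_num) ht n
  have e : (5 / 6 : ℝ) * ((18470750 : ℕ) / ((1000000 : ℕ) * (3 : ℕ) * (2 : ℕ))) = 73883 / 28800 := by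
    norm_num
  rw [e] at h
  simpa using h

/-- **Speed `9/20`, relative form**: `#{ω ∈ SAW_n : x(ω_n) ≥ 9n/20} ≤ 2⁴¹ · e^{-n/68} · cₙ`
(`ρ = 2.565382/2.604 = 0.98517… ≤ 1 - 1/68 ≤ e^{-1/68}`; the exact rate of this tilt at this speed is `0.01508`).
[cite: DuminilCopinHammond2013, Theorem 1.1; PonitzTittmann2000, §3] -/
theorem card_xEnd_ge_nineTwentieths_le_exp (n : ℕ) :
    (((Zd.saws 2 n).filter fun ω => (9 / 20 : ℝ) * n ≤ ((ω n 0 : ℤ) : ℝ)).card : ℝ) ≤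
      2 ^ 41 * Real.exp (-(n / 68 : ℝ)) * Zd.count 2 n := by
  have h0 : (0 : ℝ) ≤ ((2 : ℕ) / (3 : ℕ) : ℝ) := by norm_num
  have ht : ((2 : ℕ) / (3 : ℕ) : ℝ) ^ (9 / 20 : ℝ) ≤ 5 / 6 := by
    have h20 : (((2 : ℕ) / (3 : ℕ) : ℝ) ^ (9 / 20 : ℝ)) ^ (20 : ℕ) ≤ (5 / 6 : ℝ) ^ (20 : ℕ) := by
      rw [← Real.rpow_natCast, ← Real.rpow_mul h0]
      norm_num
    exact (pow_le_pow_iff_left₀ (Real.rpow_nonneg h0 _) (by norm_num) (by norm_num)).1 h20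
  have h := card_speed_le_mul_count_of_checkW checkW_16_3_2 (by norm_num) (by norm_num) (by norm_num)
    (by norm_num) ht (by norm_num : (0 : ℝ) < 2.604) mulo_le n
  have h' : (((Zd.saws 2 n).filter fun ω => (9 / 20 : ℝ) * n ≤ ((ω n 0 : ℤ) : ℝ)).card : ℝ) ≤
      2 ^ 41 * ((5 / 6 : ℝ) * ((18470750 : ℕ) / ((1000000 : ℕ) * (3 : ℕ) * (2 : ℕ))) / 2.604) ^ n *
        Zd.count 2 n := by
    simpa using h
  refine le_trans h' ?_
  have hρ : (5 / 6 : ℝ) * ((18470750 : ℕ) / ((1000000 : ℕ) * (3 : ℕ) * (2 : ℕ))) / 2.604 ≤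
      Real.exp (-(1 / 68 : ℝ)) := le_trans (by norm_num) (Real.add_one_le_exp (-(1 / 68 : ℝ)))
  have hρ0 : (0 : ℝ) ≤ (5 / 6 : ℝ) * ((18470750 : ℕ) / ((1000000 : ℕ) * (3 : ℕ) * (2 : ℕ))) / 2.604 := by
    norm_num
  have : ((5 / 6 : ℝ) * ((18470750 : ℕ) / ((1000000 : ℕ) * (3 : ℕ) * (2 : ℕ))) / 2.604) ^ n ≤
      Real.exp (-(n / 68 : ℝ)) := by
    refine le_trans (pow_le_pow_left₀ hρ0 hρ n) ?_
    rw [← Real.exp_nat_mul]; apply le_of_eq; congr 1; ring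
  gcongr

namespace Zd

/-- **Explicit Hammersley–Welsh on `ℤ²` with the constant `π(3/10)^{1/2} ≈ 1.7207`: for every `N ≥ 5400`,
`c_N ≤ e^{π√(3N/10) + 3π²/20 + 1} · μ^{N+1}`** (speed `9/20` from the tilt-`3/2` certificate, `W = 2⁴¹`,
`ε = 1/68`, `c = 1/69`; the binding side condition is `π²·9·(11·69/9 + 1)² = 65536 π² ≤ 120 N`, i.e.
`N ≥ 5391`). Printed: `B > π(2/3)^{1/2}` with an inexplicit `N₀(B)` (Madras–Slade Theorem 3.1.1); the tree's
speed-`1/2` theorem `Zd.count_le_exp_sharp_two` has `π(1/3)^{1/2} ≈ 1.8138` and `N ≥ 791`.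
[cite: MadrasSlade1993, Theorem 3.1.1; Hutchcroft2018HammersleyWelsh, Theorems 1.2 and 1.4; DuminilCopinHammond2013, Theorem 1.1] -/
theorem count_le_exp_nineTwentieths_two (N : ℕ) (hN : 5400 ≤ N) :
    (count 2 N : ℝ) ≤
      Real.exp (Real.pi * Real.sqrt (3 * N / 10) + 3 * Real.pi ^ 2 / 20 + 1) * connectiveConstant 2 ^ (N + 1) := by
  have hN' : (5400 : ℝ) ≤ N := by exact_mod_cast hN
  have hπ0 : 0 < Real.pi := Real.pi_pos
  have hπ1 : Real.pi < 3.1416 := Real.pi_lt_d4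
  have hπ2 : Real.pi ^ 2 < 3.1416 ^ 2 := by nlinarith
  have hendpoint : ∀ m : ℕ, 1 ≤ m →
      ((((saws 2 m).filter fun ω => (((9 : ℕ) : ℝ) / ((20 : ℕ) : ℝ)) * m ≤ ((ω m 0 : ℤ) : ℝ)).card : ℝ)
        ≤ 2 ^ 41 * Real.exp (-((1 / 68 : ℝ) * m)) * (count 2 m : ℝ)) := by
    intro m _
    have h := card_xEnd_ge_nineTwentieths_le_exp m
    have e : -((m : ℝ) / 68) = -((1 / 68 : ℝ) * m) := by ring
    rw [e] at h
    simpa only [Nat.cast_ofNat] using h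
  have key := count_le_exp_sharp_two_of_endpointBoundQ (p := 9) (q := 20) (by norm_num) (by norm_num)
    (by norm_num) hendpoint (c := 1 / 69) (by norm_num) (by norm_num) N ?_ ?_
  · have e2 : (2 * ((9 : ℕ) : ℝ) * N / (3 * ((20 : ℕ) : ℝ))) = 3 * N / 10 := by push_cast; ring
    have e3 : Real.pi ^ 2 * ((9 : ℕ) : ℝ) / (3 * ((20 : ℕ) : ℝ)) = 3 * Real.pi ^ 2 / 20 := by push_cast; ring
    rw [e2, e3] at key
    exact key
  · push_cast
    nlinarith
  · have e1 : (((((20 : ℕ) : ℝ)) - ((9 : ℕ) : ℝ)) / (((9 : ℕ) : ℝ) * (1 / 69)) + 1) ^ 2 = 65536 / 9 := by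
      push_cast; norm_num
    rw [e1]
    push_cast
    nlinarith

end Zd

end Literature.Probability.RandomPlanarGeometry.SAW

end
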